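import Literature.NumberTheory.EllipticCurves.TwoIsogenySelmerXCubeAddPXRankZero
import Mathlib.NumberTheory.LegendreSymbol.QuadraticReciprocity
import Mathlib.Tactic.NormNum.LegendreSymbol
import HarnessLib

set_option linter.dupNamespace false -- `Summit.BirchSwinnertonDyer.BirchSwinnertonDyer.Theorems.…` (summit = sub)
set_option autoImplicit false

/-!
# Crux `HeegnerTwistCouplingInSupply` (stmt-BirchSwinnertonDyer-21381) — the QUARTIC `j = 1728` corner, 0:
# local obstructions for diagonal quartics `w² = c u⁴ + c′ z⁴` and residues modulo `p`

Route `BiquadraticEisensteinDescent` (cell `pub/bsd-wall`, width seat `bsd-wall-cm-bed-w4` g13; `--supports` 21381, helper;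
LEAD-VERDICT-ibd-p1-g11 §4 (ii) «other `j = 1728` curves»). The congruent corners `W = E_{2p}`, `E_p` of this layer use
Monsky's matrices (full rational `2`-torsion). The simplest NON-congruent `j = 1728` family in the crux habitat (CM by
`ℤ[i]`, `p ≡ 3 (mod 4)` inert and bad, root number `−1`) is `W = W_p⁻ : y² = x³ − p·x` with `p ≡ 7 (mod 8)` (`S(0,−p) = {1,−p}`,
`S(0,4p) = {1,2,p,2p}`: odd `2`-Selmer parity), which has ONE rational `2`-torsion point; its quadratic twists
`W^{(d)} : y² = x³ − d²p·x` are again of the shape `y² = x³ + Dx`, so Silverman's descent via `2`-isogeny (AEC X.4.9 / X.6,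
PROVED in the tree: `TwoIsogenySelmerGroup*`, `XCubeAddDXSharpRankSha`) applies; the homogeneous spaces are the DIAGONAL
quartics `w² = c u⁴ + c′ z⁴` (`twoIsogenyQuartic 0 c c'`).

Numerics (BSD Lemmas 6/7) show that a PRIME Heegner twist `d = −q` is structurally blind here (`S(0,−pq²) = {1,−p,−q,pq}`,
`S(0,4pq²) = {1,2,p,2p}`: quadratic reciprocity and the Heegner condition force `(p/q) = +1`, so no class dies at `q` on the
`4pq²` side), while the COMPOSITE twist `d = −5q` with a prime `q ≡ 3 (mod 8)`, `(q/p) = −1`, is sharp exactly when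
`p ≡ 4 (mod 5)` (`p` a square but not a fourth power modulo the partner `5`). This file supplies the tools for that descent
(siblings `…QuarticTwistDescent` / `…QuarticTwistDescentDual` / `…QuarticTwistCorner`):

* §1 three generic local obstructions for diagonal quartics: `not_isSoluble_padic_of_dvd_of_dvd` («`ℓ ∣ c`, `ℓ ∣ c′` and the
  reduced form `(c/ℓ)x⁴ + (c′/ℓ)y⁴` anisotropic mod `ℓ`»), `not_isSoluble_padic_of_sq_mul` («`c` a non-residue, `c′ = ℓ²c″`
  with `c″` a non-residue mod `ℓ`»), `not_isSoluble_two_of_zmod8` («no solutions modulo `8` in either chart»); the fourth,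
  «`ℓ ∥ c`, `c′` a non-residue», is the tree's `XCubeAddPX.not_isSoluble_padic_diagonal` (`not_isSoluble_padic_of_dvd_left/right`);
* §2 the residue bookkeeping modulo `p` for `p ≡ 7 (mod 8)`, `p ≡ 4 (mod 5)`, `(q/p) = −1` (`nonresidues_mod_p`).

HONEST FRAMING: tools for a typed sub-corner on one CM family (measure zero in «all CM `W`»); the crux (residual C⁺) is
untouched; BSD is not proved by any of this. THEOREMS ONLY (no `def`, no named fact, no sorry). Supports stmt-BirchSwinnertonDyer-21381.
-/

noncomputable section

open scoped Classical

namespace Summit.BirchSwinnertonDyer.BirchSwinnertonDyer.Theorems.BiquadraticEisensteinDescentHeegnerTwistCouplingInSupplyQuarticTwistLocal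

open Literature.NumberTheory.EllipticCurves Literature.NumberTheory.EllipticCurves.XCubeAddPX

/-! ## §1 Generic local obstructions for diagonal quartics `w² = c u⁴ + c′ z⁴` -/

section Local

variable {ℓ : ℕ} [hl : Fact ℓ.Prime]

/-- Values of `twoIsogenyQuartic 0 c c'` after base change: `c u⁴ + c′ z⁴`. [folklore] -/
theorem eval_map_quartic_zero {S : Type*} [CommRing S] (φ : ℤ →+* S) (c c' : ℤ) (x y : S) :
    ((twoIsogenyQuartic 0 c c').map φ).eval x y = φ c * x ^ 4 + φ c' * y ^ 4 := by
  rw [eval_map_twoIsogenyQuartic, map_zero, zero_mul, zero_mul, add_zero]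

/-- `toZMod ℓ = 0` in `ℤ_ℓ`. [folklore] -/
theorem toZMod_natCast_self : PadicInt.toZMod (ℓ : ℤ_[ℓ]) = 0 := by
  rw [map_natCast, ZMod.natCast_self]

/-- From `z² = ℓ·B` in `ℤ_ℓ`: `B ≡ 0 (mod ℓ)` (as `ℓ ∣ z`, `ℓ² ∣ z² = ℓB`). [folklore] -/
theorem toZMod_eq_zero_of_sq_eq_mul (z B : ℤ_[ℓ]) (h : z ^ 2 = (ℓ : ℤ_[ℓ]) * B) :
    PadicInt.toZMod B = 0 := by
  have hl0 : (ℓ : ℤ_[ℓ]) ≠ 0 := by exact_mod_cast hl.out.ne_zero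
  have hz : PadicInt.toZMod z = 0 := by
    have hbar := congrArg PadicInt.toZMod h
    rw [map_pow, map_mul, toZMod_natCast_self, zero_mul] at hbar
    exact pow_eq_zero_iff two_ne_zero |>.mp hbar
  obtain ⟨z₁, hz₁⟩ := (BinaryQuartic.toZMod_eq_zero_iff z).mp hz
  have hB : B = (ℓ : ℤ_[ℓ]) * z₁ ^ 2 := by
    apply mul_left_cancel₀ hl0
    rw [← h, hz₁]
    ring
  rw [hB, map_mul, toZMod_natCast_self, zero_mul]

/-- **Obstruction «both coefficients divisible by `ℓ`, reduced form anisotropic».** If `c = ℓc₀`, `c′ = ℓc₀′` and the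
form `c₀x⁴ + c₀′y⁴` has no non-trivial zero modulo `ℓ`, then `w² = c u⁴ + c′ z⁴` has no `ℚ_ℓ`-point: an integral point
with a coordinate `1` gives `ℓ ∣ w`, hence `c₀u⁴ + c₀′z⁴ ≡ 0 (mod ℓ)` with `(u, z) ≢ (0, 0)`.
(For the twist classes `−5q`, `5pq` at `ℓ = 5`, and `5, 5p, 10, 10p` of the dual side.)
[cite: SilvermanAEC2009, Prop. X.4.9 and proof of Prop. X.6.2(b)] -/
theorem not_isSoluble_padic_of_dvd_of_dvd {c c' c₀ c₀' : ℤ} (hc : c = ℓ * c₀) (hc' : c' = ℓ * c₀')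
    (h : ∀ x y : ZMod ℓ, (c₀ : ZMod ℓ) * x ^ 4 + (c₀' : ZMod ℓ) * y ^ 4 = 0 → x = 0 ∧ y = 0) :
    ¬ ((twoIsogenyQuartic 0 c c').map (Int.castRingHom ℚ_[ℓ])).IsSoluble := by
  intro hsol
  rw [← BinaryQuartic.map_intCast_map_coe, BinaryQuartic.isSoluble_map_coe_iff] at hsol
  have hev : ∀ x y : ℤ_[ℓ], ((twoIsogenyQuartic 0 c c').map (Int.castRingHom ℤ_[ℓ])).eval x y
      = (ℓ : ℤ_[ℓ]) * ((c₀ : ℤ_[ℓ]) * x ^ 4 + (c₀' : ℤ_[ℓ]) * y ^ 4) := fun x y => by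
    rw [eval_map_quartic_zero, hc, hc']
    simp only [eq_intCast, Int.cast_mul, Int.cast_natCast]
    ring
  rcases hsol with ⟨t, z, ht⟩ | ⟨t, z, ht⟩
  · rw [hev] at ht
    have hB := toZMod_eq_zero_of_sq_eq_mul z _ ht
    rw [map_add, map_mul, map_mul, map_pow, map_pow, map_intCast, map_intCast, map_one] at hB
    exact one_ne_zero (h 1 (PadicInt.toZMod t) hB).1
  · rw [hev] at ht
    have hB := toZMod_eq_zero_of_sq_eq_mul z _ ht
    rw [map_add, map_mul, map_mul, map_pow, map_pow, map_intCast, map_intCast, map_one] at hB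
    exact one_ne_zero (h (PadicInt.toZMod t) 1 hB).2

/-- **Obstruction «`c` a non-residue, `c′ = ℓ²·c″` with `c″` a non-residue».** Then `w² = c u⁴ + c′ z⁴` has no
`ℚ_ℓ`-point: in the chart `u = 1`, `w² ≡ c`; in the chart `z = 1`, a unit `u` gives `c ≡ (w/u²)²` and `ℓ ∣ u` gives
`ℓ ∣ w`, `(w/ℓ)² ≡ c″`. (For the classes `2, 2p, 5, 5p, 10, 10p` of the dual side, at `ℓ = 5` or `ℓ = q`.)
[cite: SilvermanAEC2009, Prop. X.4.9 and proof of Prop. X.6.2(b)] -/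
theorem not_isSoluble_padic_of_sq_mul {c c' c'' : ℤ} (hc' : c' = (ℓ : ℤ) ^ 2 * c'')
    (hc : ¬ IsSquare ((c : ℤ) : ZMod ℓ)) (hc'' : ¬ IsSquare ((c'' : ℤ) : ZMod ℓ)) :
    ¬ ((twoIsogenyQuartic 0 c c').map (Int.castRingHom ℚ_[ℓ])).IsSoluble := by
  intro hsol
  rw [← BinaryQuartic.map_intCast_map_coe, BinaryQuartic.isSoluble_map_coe_iff] at hsol
  have hl0 : (ℓ : ℤ_[ℓ]) ≠ 0 := by exact_mod_cast hl.out.ne_zero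
  have hev : ∀ x y : ℤ_[ℓ], ((twoIsogenyQuartic 0 c c').map (Int.castRingHom ℤ_[ℓ])).eval x y
      = (c : ℤ_[ℓ]) * x ^ 4 + (ℓ : ℤ_[ℓ]) ^ 2 * (c'' : ℤ_[ℓ]) * y ^ 4 := fun x y => by
    rw [eval_map_quartic_zero, hc']
    simp only [eq_intCast, Int.cast_mul, Int.cast_pow, Int.cast_natCast]
  rcases hsol with ⟨t, z, ht⟩ | ⟨t, z, ht⟩
  · -- chart `u = 1`: `z² = c + ℓ² c″ t⁴ ≡ c`
    rw [hev, one_pow, mul_one] at ht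
    have hbar := congrArg PadicInt.toZMod ht
    simp only [map_pow, map_add, map_mul, map_natCast, ZMod.natCast_self, map_intCast, zero_mul,
      zero_pow two_ne_zero, add_zero] at hbar
    exact hc ⟨PadicInt.toZMod z, by rw [← sq, hbar]⟩
  · -- chart `z = 1`: `z² = c t⁴ + ℓ² c″`
    rw [hev, one_pow, mul_one] at ht
    by_cases htu : PadicInt.toZMod t = 0
    · obtain ⟨s, hs⟩ := (BinaryQuartic.toZMod_eq_zero_iff t).mp htu
      -- `ℓ ∣ z`
      have hz : PadicInt.toZMod z = 0 := by
        have hbar := congrArg PadicInt.toZMod ht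
        rw [hs] at hbar
        simp only [map_pow, map_add, map_mul, map_natCast, ZMod.natCast_self, map_intCast, zero_mul,
          zero_pow four_ne_zero, mul_zero, zero_add, zero_pow two_ne_zero] at hbar
        exact pow_eq_zero_iff two_ne_zero |>.mp hbar
      obtain ⟨w, hw⟩ := (BinaryQuartic.toZMod_eq_zero_iff z).mp hz
      -- `w² = ℓ² c s⁴ + c″`
      have hw2 : w ^ 2 = (ℓ : ℤ_[ℓ]) ^ 2 * (c : ℤ_[ℓ]) * s ^ 4 + (c'' : ℤ_[ℓ]) := by
        apply mul_left_cancel₀ (pow_ne_zero 2 hl0)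
        have : ((ℓ : ℤ_[ℓ]) * w) ^ 2 = (c : ℤ_[ℓ]) * ((ℓ : ℤ_[ℓ]) * s) ^ 4 + (ℓ : ℤ_[ℓ]) ^ 2 * (c'' : ℤ_[ℓ]) := by
          rw [← hw, ← hs, ht]
        linear_combination this
      have hbar := congrArg PadicInt.toZMod hw2
      simp only [map_pow, map_add, map_mul, map_natCast, ZMod.natCast_self, map_intCast, zero_mul,
        zero_pow two_ne_zero, zero_add] at hbar
      exact hc'' ⟨PadicInt.toZMod w, by rw [← sq, hbar]⟩
    · have hbar := congrArg PadicInt.toZMod ht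
      simp only [map_pow, map_add, map_mul, map_natCast, ZMod.natCast_self, map_intCast, zero_mul,
        zero_pow two_ne_zero, add_zero] at hbar
      apply hc
      refine ⟨PadicInt.toZMod z / PadicInt.toZMod t ^ 2, ?_⟩
      field_simp
      linear_combination -hbar

/-- **The `2`-adic obstruction «no solutions modulo `8`»**: if neither `z̄² = c + c′t̄⁴` nor `z̄² = c t̄⁴ + c′` is
solvable in `ℤ/8`, then `w² = c u⁴ + c′ z⁴` has no `ℚ₂`-point (an integral point has a coordinate `1`).
[cite: SilvermanAEC2009, proof of Prop. X.6.2(b) («no solutions modulo 16»)] -/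
theorem not_isSoluble_two_of_zmod8 {c c' : ℤ}
    (h : ∀ z t : ZMod (2 ^ 3), z ^ 2 ≠ (c : ZMod (2 ^ 3)) + (c' : ZMod (2 ^ 3)) * t ^ 4 ∧
      z ^ 2 ≠ (c : ZMod (2 ^ 3)) * t ^ 4 + (c' : ZMod (2 ^ 3))) :
    ¬ ((twoIsogenyQuartic 0 c c').map (Int.castRingHom ℚ_[2])).IsSoluble := by
  intro hsol
  rw [← BinaryQuartic.map_intCast_map_coe, BinaryQuartic.isSoluble_map_coe_iff] at hsol
  rcases hsol with ⟨t, z, he⟩ | ⟨t, z, he⟩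
  · rw [eval_map_quartic_zero, one_pow, mul_one] at he
    have hbar := congrArg (PadicInt.toZModPow 3) he
    simp only [map_pow, map_add, map_mul, eq_intCast, map_intCast] at hbar
    exact (h _ _).1 hbar
  · rw [eval_map_quartic_zero, one_pow, mul_one] at he
    have hbar := congrArg (PadicInt.toZModPow 3) he
    simp only [map_pow, map_add, map_mul, eq_intCast, map_intCast] at hbar
    exact (h _ _).2 hbar

/-- The tree's diagonal obstruction «`ℓ ∥ c′`, `c` a non-residue mod `ℓ`» in `twoIsogenyQuartic` dress (second
coefficient divisible by `ℓ`). [cite: SilvermanAEC2009, proof of Prop. X.6.2(b)] -/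
theorem not_isSoluble_padic_of_dvd_right {c c' : ℤ} (h1 : (ℓ : ℤ) ∣ c') (h2 : ¬ (ℓ : ℤ) ^ 2 ∣ c')
    (hc : ¬ IsSquare ((c : ℤ) : ZMod ℓ)) :
    ¬ ((twoIsogenyQuartic 0 c c').map (Int.castRingHom ℚ_[ℓ])).IsSoluble := by
  rw [isSoluble_map_twoIsogenyQuartic_comm]
  exact not_isSoluble_padic_diagonal (p := ℓ) (A := c') (E := c) h1 h2 hc

/-- The same with the first coefficient divisible by `ℓ`. [cite: SilvermanAEC2009, proof of Prop. X.6.2(b)] -/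
theorem not_isSoluble_padic_of_dvd_left {c c' : ℤ} (h1 : (ℓ : ℤ) ∣ c) (h2 : ¬ (ℓ : ℤ) ^ 2 ∣ c)
    (hc' : ¬ IsSquare ((c' : ℤ) : ZMod ℓ)) :
    ¬ ((twoIsogenyQuartic 0 c c').map (Int.castRingHom ℚ_[ℓ])).IsSoluble :=
  not_isSoluble_padic_diagonal (p := ℓ) (A := c) (E := c') h1 h2 hc'

/-- `ℓ² ∤ ℓ·m` when `ℓ ∤ m`. [folklore] -/
theorem not_sq_dvd_mul_of_not_dvd {m : ℤ} (hm : ¬ (ℓ : ℤ) ∣ m) : ¬ (ℓ : ℤ) ^ 2 ∣ (ℓ : ℤ) * m := by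
  rintro ⟨k, hk⟩
  have hl0 : (ℓ : ℤ) ≠ 0 := by exact_mod_cast hl.out.ne_zero
  exact hm ⟨k, mul_left_cancel₀ hl0 (by linear_combination hk)⟩

/-- In a field: non-residue × non-zero square is a non-residue. [folklore] -/
theorem not_isSquare_mul_of_isSquare {F : Type*} [Field F] {a b : F} (ha : ¬ IsSquare a) (hb : IsSquare b)
    (hb0 : b ≠ 0) : ¬ IsSquare (a * b) := by
  rintro ⟨x, hx⟩
  obtain ⟨y, hy⟩ := hb
  have hy0 : y ≠ 0 := fun h0 => hb0 (by rw [hy, h0, mul_zero])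
  exact ha ⟨x / y, by rw [div_mul_div_comm, ← hx, hy, mul_div_assoc, div_self (mul_ne_zero hy0 hy0), mul_one]⟩

end Local

/-! ## §2 Residues modulo `p` (`p ≡ 7 (mod 8)`, `p ≡ 4 (mod 5)`, `q` a non-residue) -/

section Residues

variable {p q : ℕ} [hp : Fact p.Prime]

/-- `−1` is a non-residue mod `p ≡ 3 (mod 4)`. [folklore] -/
theorem not_isSquare_neg_one (hp4 : p % 4 = 3) : ¬ IsSquare (((-1 : ℤ) : ℤ) : ZMod p) := by
  push_cast
  exact (ZMod.exists_sq_eq_neg_one_iff (p := p)).not.mpr (by omega)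

/-- `2` is a residue mod `p ≡ 7 (mod 8)`. [folklore] -/
theorem isSquare_two (hp8 : p % 8 = 7) : IsSquare ((2 : ℤ) : ZMod p) := by
  push_cast
  exact (ZMod.exists_sq_eq_two_iff (by rintro rfl; omega)).mpr (Or.inr hp8)

/-- `5` is a residue mod `p ≡ ±1 (mod 5)` (`p ≠ 2`): `(5/p) = (p/5) = 1`. [folklore] -/
theorem isSquare_five (hp2 : p ≠ 2) (hp5 : p % 5 = 1 ∨ p % 5 = 4) : IsSquare ((5 : ℤ) : ZMod p) := by
  haveI : Fact (Nat.Prime 5) := ⟨Nat.prime_five⟩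
  have h5 : ((5 : ℤ) : ZMod p) ≠ 0 := by
    intro h0
    have : (p : ℤ) ∣ 5 := (ZMod.intCast_zmod_eq_zero_iff_dvd 5 p).mp h0
    have hp5' : p ∣ 5 := by exact_mod_cast this
    rcases (Nat.dvd_prime Nat.prime_five).mp hp5' with h | h
    · exact hp.out.one_lt.ne' h
    · omega
  rw [← legendreSym.eq_one_iff p h5]
  have hrec : legendreSym p 5 = legendreSym 5 p :=
    legendreSym.quadratic_reciprocity_one_mod_four (p := 5) (q := p) (by norm_num) hp2
  rw [hrec, legendreSym.mod 5 (p : ℤ)]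
  have : (p : ℤ) % ((5 : ℕ) : ℤ) = 1 ∨ (p : ℤ) % ((5 : ℕ) : ℤ) = 4 := by push_cast; omega
  rcases this with h | h <;> rw [h] <;> norm_num

/-- Products: for `p ≡ 7 (mod 8)`, `p ≡ 4 (mod 5)` and `q` a non-residue, the integers
`−1, q, −5, 5q, 25q, −25q², −5q², 2q, 50q, 20q, 100q` are non-residues mod `p`. [folklore] -/
theorem nonresidues_mod_p (hp8 : p % 8 = 7) (hp5 : p % 5 = 4) (hq : q.Prime) (hqp : q ≠ p)
    (hnq : ¬ IsSquare ((q : ℤ) : ZMod p)) :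
    ¬ IsSquare (((-1 : ℤ)) : ZMod p) ∧ ¬ IsSquare (((-5 : ℤ)) : ZMod p) ∧
    ¬ IsSquare (((5 * q : ℤ)) : ZMod p) ∧ ¬ IsSquare (((25 * q : ℤ)) : ZMod p) ∧
    ¬ IsSquare (((-(25 * q ^ 2) : ℤ)) : ZMod p) ∧ ¬ IsSquare (((-(5 * q ^ 2) : ℤ)) : ZMod p) ∧
    ¬ IsSquare (((2 * q : ℤ)) : ZMod p) ∧ ¬ IsSquare (((50 * q : ℤ)) : ZMod p) ∧
    ¬ IsSquare (((20 * q : ℤ)) : ZMod p) ∧ ¬ IsSquare (((100 * q : ℤ)) : ZMod p) := by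
  have hP := hp.out
  have hm1 := not_isSquare_neg_one (p := p) (by omega)
  have h2 := isSquare_two (p := p) hp8
  have h5 := isSquare_five (p := p) (by rintro rfl; omega) (Or.inr hp5)
  have hq0 : ((q : ℤ) : ZMod p) ≠ 0 := by
    intro h0
    have : (p : ℤ) ∣ q := (ZMod.intCast_zmod_eq_zero_iff_dvd q p).mp h0
    have : p ∣ q := by exact_mod_cast this
    exact hqp ((Nat.prime_dvd_prime_iff_eq hP hq).mp this).symm
  have h50 : ((5 : ℤ) : ZMod p) ≠ 0 := by
    intro h0
    have : (p : ℤ) ∣ 5 := (ZMod.intCast_zmod_eq_zero_iff_dvd 5 p).mp h0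
    have h' : p ∣ 5 := by exact_mod_cast this
    rcases (Nat.dvd_prime Nat.prime_five).mp h' with h | h
    · exact hP.one_lt.ne' h
    · omega
  have h20 : ((2 : ℤ) : ZMod p) ≠ 0 := by
    intro h0
    have : (p : ℤ) ∣ 2 := (ZMod.intCast_zmod_eq_zero_iff_dvd 2 p).mp h0
    have h' : p ∣ 2 := by exact_mod_cast this
    rcases (Nat.dvd_prime Nat.prime_two).mp h' with h | h
    · exact hP.one_lt.ne' h
    · omega
  have hsq : ∀ x : ZMod p, IsSquare (x ^ 2) := fun x => ⟨x, sq x⟩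
  have hq2 : IsSquare (((q : ℤ) : ZMod p) ^ 2) := hsq _
  have hq20 : (((q : ℤ) : ZMod p) ^ 2) ≠ 0 := pow_ne_zero 2 hq0
  have h25 : IsSquare ((25 : ℤ) : ZMod p) := ⟨5, by push_cast; norm_num⟩
  have h250 : ((25 : ℤ) : ZMod p) ≠ 0 := by
    have : ((25 : ℤ) : ZMod p) = ((5 : ℤ) : ZMod p) ^ 2 := by push_cast; norm_num
    rw [this]; exact pow_ne_zero 2 h50
  have h100 : IsSquare ((100 : ℤ) : ZMod p) := ⟨10, by push_cast; norm_num⟩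
  have h1000 : ((100 : ℤ) : ZMod p) ≠ 0 := by
    have : ((100 : ℤ) : ZMod p) = (((2 : ℤ) : ZMod p) * ((5 : ℤ) : ZMod p)) ^ 2 := by push_cast; norm_num
    rw [this]; exact pow_ne_zero 2 (mul_ne_zero h20 h50)
  have h4 : IsSquare ((4 : ℤ) : ZMod p) := ⟨2, by push_cast; norm_num⟩
  have h40 : ((4 : ℤ) : ZMod p) ≠ 0 := by
    have : ((4 : ℤ) : ZMod p) = ((2 : ℤ) : ZMod p) ^ 2 := by push_cast; norm_num
    rw [this]; exact pow_ne_zero 2 h20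
  have e1 : ((-5 : ℤ) : ZMod p) = ((-1 : ℤ) : ZMod p) * ((5 : ℤ) : ZMod p) := by push_cast; ring
  have e2 : ((5 * q : ℤ) : ZMod p) = ((q : ℤ) : ZMod p) * ((5 : ℤ) : ZMod p) := by push_cast; ring
  have e3 : ((25 * q : ℤ) : ZMod p) = ((q : ℤ) : ZMod p) * ((25 : ℤ) : ZMod p) := by push_cast; ring
  have e4 : ((-(25 * q ^ 2) : ℤ) : ZMod p) = ((-1 : ℤ) : ZMod p) * ((25 : ℤ) : ZMod p) * ((q : ℤ) : ZMod p) ^ 2 := by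
    push_cast; ring
  have e5 : ((-(5 * q ^ 2) : ℤ) : ZMod p) = ((-1 : ℤ) : ZMod p) * ((5 : ℤ) : ZMod p) * ((q : ℤ) : ZMod p) ^ 2 := by
    push_cast; ring
  have e6 : ((2 * q : ℤ) : ZMod p) = ((q : ℤ) : ZMod p) * ((2 : ℤ) : ZMod p) := by push_cast; ring
  have e7 : ((50 * q : ℤ) : ZMod p) = ((q : ℤ) : ZMod p) * ((2 : ℤ) : ZMod p) * ((25 : ℤ) : ZMod p) := by
    push_cast; ring
  have e8 : ((20 * q : ℤ) : ZMod p) = ((q : ℤ) : ZMod p) * ((5 : ℤ) : ZMod p) * ((4 : ℤ) : ZMod p) := by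
    push_cast; ring
  have e9 : ((100 * q : ℤ) : ZMod p) = ((q : ℤ) : ZMod p) * ((100 : ℤ) : ZMod p) := by push_cast; ring
  refine ⟨hm1, ?_, ?_, ?_, ?_, ?_, ?_, ?_, ?_, ?_⟩
  · rw [e1]; exact not_isSquare_mul_of_isSquare hm1 h5 h50
  · rw [e2]; exact not_isSquare_mul_of_isSquare hnq h5 h50
  · rw [e3]; exact not_isSquare_mul_of_isSquare hnq h25 h250
  · rw [e4]; exact not_isSquare_mul_of_isSquare (not_isSquare_mul_of_isSquare hm1 h25 h250) hq2 hq20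
  · rw [e5]; exact not_isSquare_mul_of_isSquare (not_isSquare_mul_of_isSquare hm1 h5 h50) hq2 hq20
  · rw [e6]; exact not_isSquare_mul_of_isSquare hnq h2 h20
  · rw [e7]; exact not_isSquare_mul_of_isSquare (not_isSquare_mul_of_isSquare hnq h2 h20) h25 h250
  · rw [e8]; exact not_isSquare_mul_of_isSquare (not_isSquare_mul_of_isSquare hnq h5 h50) h4 h40
  · rw [e9]; exact not_isSquare_mul_of_isSquare hnq h100 h1000

end Residues

end Summit.BirchSwinnertonDyer.BirchSwinnertonDyer.Theorems.BiquadraticEisensteinDescentHeegnerTwistCouplingInSupplyQuarticTwistLocal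

end
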